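import Mathlib
import Summits.ValiantsHypothesis.ValiantsHypothesis.Theorems.FifoMatchingNNLinearDegreeCofactorHardQueueGenerations
import HarnessLib

/-!
# Crux `NNLinearDegreeCofactorHard` (stmt-ValiantsHypothesis-23918), line `internal_cofactor`: FREE MASS on the abstract
# queue history (unit U2 of (D*), design memo §3)

On a COMPLETE abstract queue history of length `M` (`rO 0 = rC 0 = 0`, `rO M = rC M = n'`: every item is pushed and popped inside
`[0, M)`) with a RESPECTED colouring (`σ (o k) = σ (c k)`), every position is the push or the pop of exactly one item and carries
that item's colour.  Hence

* `two_mul_card_items_colour` — `2 · #{k < n' : σ (o k) = b} = #{t < M : σ t = b}`;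
* `le_six_mul_card_items_colour` — if `σ` is BALANCED (`M < 3·#{t < M : σ t} ≤ 2M`, the split window of
  `…AvoidingCounts.lt_complexity_of_counts` with `M = 2·C.m`) then each colour owns at least `M/6` items:
  `M ≤ 6 · #{k < n' : σ (o k) = b}` for both `b`.

The μ* free-mass budget follows in the instantiation: S-items of a colour ≥ items of that colour − #R-items (= |R′|).
Deterministic; nothing here proves S2b, the crux or VP ≠ VNP (not proved). [folklore]
-/

-- Sub = Summit single-conjunct layout: the duplicated namespace component is mandated by the tree.
set_option linter.dupNamespace false

namespace Summit.ValiantsHypothesis.ValiantsHypothesis.Theorems.FifoMatching.NNLinearDegreeCofactorHard.QueueHistory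

open Finset
open Summit.ValiantsHypothesis.ValiantsHypothesis.Theorems.FifoMatching.NNMonotoneHard

section AbstractQueue

variable {W σ : ℕ → Bool} {rO rC o c : ℕ → ℕ} {n' : ℕ}
variable (hOs : ∀ t, rO (t + 1) = rO t + (if W t = true then 1 else 0))
  (hCs : ∀ t, rC (t + 1) = rC t + (if W t = true then 0 else 1))
  (ho : ∀ k t, k < n' → (o k < t ↔ k < rO t))
  (hc : ∀ k t, k < n' → (c k < t ↔ k < rC t))
  (hresp : ∀ k, k < n' → σ (o k) = σ (c k))

include hOs ho in
/-- **Push times of `[0, M)` ↔ items**, colour-preservingly: `#{t < M : W t ∧ σ t = b} = #{k < n' : σ (o k) = b}` when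
`rO M = n'`. [folklore] -/
theorem card_pushTimes_colour {M : ℕ} (hOM : rO M = n') (b : Bool) :
    ((range M).filter fun t => W t = true ∧ σ t = b).card = ((range n').filter fun k => σ (o k) = b).card := by
  classical
  rw [← card_image_of_injOn (f := rO)]
  · congr 1
    ext k
    simp only [mem_image, mem_filter, mem_range]
    constructor
    · rintro ⟨t, ⟨htM, hW, hb⟩, rfl⟩
      have hk : rO t < n' := by
        have h1 : rO (t + 1) ≤ rO M := rankO_mono hOs (Nat.succ_le_of_lt htM)
        rw [hOs, if_pos hW] at h1; omega
      exact ⟨hk, by rw [opener_at hOs ho hW hk]; exact hb⟩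
    · rintro ⟨hk, hb⟩
      obtain ⟨hrank, hW⟩ := rankO_opener hOs ho hk
      refine ⟨o k, ⟨(ho k M hk).2 (by rw [hOM]; exact hk), hW, by rw [← hrank] at hb ⊢; rw [opener_at hOs ho hW (by rw [hrank]; exact hk)]; rw [hrank] at hb; exact hb⟩, hrank⟩
  · intro t₁ h₁ t₂ h₂ heq
    have h₁' := mem_filter.1 (mem_coe.1 h₁); have h₂' := mem_filter.1 (mem_coe.1 h₂)
    have hk₁ : rO t₁ < n' := by
      have h1 : rO (t₁ + 1) ≤ rO M := rankO_mono hOs (Nat.succ_le_of_lt (mem_range.1 h₁'.1))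
      rw [hOs, if_pos h₁'.2.1] at h1; omega
    have hk₂ : rO t₂ < n' := by
      have h1 : rO (t₂ + 1) ≤ rO M := rankO_mono hOs (Nat.succ_le_of_lt (mem_range.1 h₂'.1))
      rw [hOs, if_pos h₂'.2.1] at h1; omega
    rw [← opener_at hOs ho h₁'.2.1 hk₁, ← opener_at hOs ho h₂'.2.1 hk₂, heq]

include hCs hc hresp in
/-- **Pop times of `[0, M)` ↔ items**, colour-preservingly (respect): `#{t < M : ¬W t ∧ σ t = b} = #{k < n' : σ (o k) = b}`
when `rC M = n'`. [folklore] -/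
theorem card_popTimes_colour {M : ℕ} (hCM : rC M = n') (b : Bool) :
    ((range M).filter fun t => W t = false ∧ σ t = b).card = ((range n').filter fun k => σ (o k) = b).card := by
  classical
  rw [← card_image_of_injOn (f := rC)]
  · congr 1
    ext k
    simp only [mem_image, mem_filter, mem_range]
    constructor
    · rintro ⟨t, ⟨htM, hW, hb⟩, rfl⟩
      have hk : rC t < n' := by
        have h1 : rC (t + 1) ≤ rC M := rankC_mono hCs (Nat.succ_le_of_lt htM)
        rw [hCs, hW] at h1; simp at h1; omega
      refine ⟨hk, ?_⟩
      rw [hresp _ hk, closer_at hCs hc hW hk]; exact hb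
    · rintro ⟨hk, hb⟩
      obtain ⟨hrank, hW⟩ := rankC_closer hCs hc hk
      refine ⟨c k, ⟨(hc k M hk).2 (by rw [hCM]; exact hk), hW, ?_⟩, hrank⟩
      rw [← hresp k hk]; exact hb
  · intro t₁ h₁ t₂ h₂ heq
    have h₁' := mem_filter.1 (mem_coe.1 h₁); have h₂' := mem_filter.1 (mem_coe.1 h₂)
    have hk₁ : rC t₁ < n' := by
      have h1 : rC (t₁ + 1) ≤ rC M := rankC_mono hCs (Nat.succ_le_of_lt (mem_range.1 h₁'.1))
      rw [hCs, h₁'.2.1] at h1; simp at h1; omega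
    have hk₂ : rC t₂ < n' := by
      have h1 : rC (t₂ + 1) ≤ rC M := rankC_mono hCs (Nat.succ_le_of_lt (mem_range.1 h₂'.1))
      rw [hCs, h₂'.2.1] at h1; simp at h1; omega
    rw [← closer_at hCs hc h₁'.2.1 hk₁, ← closer_at hCs hc h₂'.2.1 hk₂, heq]

include hOs hCs ho hc hresp in
/-- **Every position carries its item's colour**: `2 · #{k < n' : σ (o k) = b} = #{t < M : σ t = b}`. [folklore] -/
theorem two_mul_card_items_colour {M : ℕ} (hOM : rO M = n') (hCM : rC M = n') (b : Bool) :
    2 * ((range n').filter fun k => σ (o k) = b).card = ((range M).filter fun t => σ t = b).card := by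
  classical
  have hP := card_pushTimes_colour (σ := σ) hOs ho hOM b
  have hQ := card_popTimes_colour (σ := σ) (o := o) hCs hc hresp hCM b
  rw [two_mul]
  nth_rewrite 1 [← hP]
  rw [← hQ, ← card_union_of_disjoint]
  · congr 1
    ext t
    simp only [mem_union, mem_filter, mem_range]
    constructor
    · rintro (⟨ht, -, hb⟩ | ⟨ht, -, hb⟩) <;> exact ⟨ht, hb⟩
    · rintro ⟨ht, hb⟩
      cases hW : W t
      · exact Or.inr ⟨ht, rfl, hb⟩
      · exact Or.inl ⟨ht, rfl, hb⟩
  · exact disjoint_filter.2 fun t _ h1 h2 => by rw [h1.1] at h2; exact Bool.noConfusion h2.1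

include hOs hCs ho hc hresp in
/-- **Free mass (U2).**  For a balanced colouring (`M < 3·#{t < M : σ t} ≤ 2M`) of a complete respected history, each colour
owns at least `M/6` items: `M ≤ 6 · #{k < n' : σ (o k) = b}`. [folklore] -/
theorem le_six_mul_card_items_colour {M : ℕ} (hOM : rO M = n') (hCM : rC M = n')
    (hbal₁ : M < 3 * ((range M).filter fun t => σ t = true).card)
    (hbal₂ : 3 * ((range M).filter fun t => σ t = true).card ≤ 2 * M) (b : Bool) :
    M ≤ 6 * ((range n').filter fun k => σ (o k) = b).card := by
  classical
  have htrue := two_mul_card_items_colour hOs hCs ho hc hresp hOM hCM true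
  have hfalse := two_mul_card_items_colour hOs hCs ho hc hresp hOM hCM false
  have hsplit : ((range M).filter fun t => σ t = true).card + ((range M).filter fun t => σ t = false).card = M := by
    have h := card_filter_add_card_filter_not (s := range M) (fun t => σ t = true)
    rw [card_range] at h
    have e : ((range M).filter fun t => ¬ σ t = true) = (range M).filter fun t => σ t = false :=
      filter_congr fun t _ => by simp
    rw [e] at h
    exact h
  cases b
  · omega
  · omega

end AbstractQueue

end Summit.ValiantsHypothesis.ValiantsHypothesis.Theorems.FifoMatching.NNLinearDegreeCofactorHard.QueueHistory
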